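import Mathlib.LinearAlgebra.Matrix.Block
import Mathlib.Analysis.Calculus.Deriv.Inv
import Literature.NumberTheory.Transcendental.KZDominatedFamily
import Literature.NumberTheory.Transcendental.SemialgebraicMapsProofs

/-!
# Route ValuedFieldSpecialisation — crux `CTConstruction`: the weight-slab blow-up exists

Helper toward crux stmt-KontsevichZagierPeriods-3495 (`CTConstruction`), line `registered`,
reshape r4 (blow-up elimination of the log block), stub `stub_exists_blowup`. An
`(n+1)`-dimensional integral representation `R` is read as the family of its slices over the
parameter `s = z 0`. The **weight-slab blow-up** `βʷR` of `R` is the family over a NEW parameter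
`σ` whose fibre over `σ` is the sub-slab `{0 < t < σ}` of the total space of `R`, weighted by
`t / σ²`: in coordinates `z = (σ, t, x)`,
`(βʷR).domain = {z | 0 < z 1 < z 0 < 1, tail z ∈ R.domain}` and
`(βʷR).integrand z = (z 1 / z 0 ^ 2) · R.integrand (tail z)` (`tail z = fun i => z i.succ`).

`stub_exists_blowup`: `βʷR` exists as an integral representation — the domain is
`ℚ`-semialgebraic (`isSemialgebraic_blowupDomain`), the integrand is `ℚ`-semialgebraic on it
(`isSemialgebraicFunOn_blowupWeight_mul`), and it is absolutely integrable WITHOUT Fubini: the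
involution `(σ, t, x) ↦ (t / σ, t, x)` of the blow-up domain has Jacobian `t / σ²`
(`blowup_involution_data`, an upper-triangular derivative, `Matrix.det_of_upperTriangular`) and
does not move the tail, so the change-of-variables formula
(`MeasureTheory.integrableOn_image_iff_integrableOn_abs_det_fderiv_smul`) turns the integrability
of `z ↦ R.integrand (tail z)` on the cylinder `(0, 1) × R.domain`
(`KZ.IntegralRep.integrableOn_cylinderDomain`) into that of the weighted integrand. Also recorded:
the preimage of a null set under the tail projection is null (`volume_setOf_tail_mem_eq_zero`),
used by the companion file `…CTConstructionBlowupMap.lean`.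

Sources: M. Kontsevich, D. Zagier, *Periods* (2001), §1.2; J. Bochnak, M. Coste, M.-F. Roy,
*Real Algebraic Geometry* (1998), §2.2 (Prop. 2.2.6, semialgebraic maps). No new definitions;
nothing here about fibred relations, dominated families or the sheared blow-up.
-/

noncomputable section

namespace Summit.KontsevichZagierPeriods.ValuedFieldSpecialisation

open MeasureTheory Set Filter MvPolynomial
open scoped Topology
open Literature.NumberTheory.Transcendental Literature.NumberTheory.Transcendental.KZ
open Literature.ModelTheory.ExponentialFields (IsSemialgebraic isSemialgebraic_setOf_eval_pos
  isSemialgebraic_setOf_eval_lt)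

/-! ## The blow-up cut, its weight, and the involution `σ ↦ t / σ` -/

/-- The blow-up domain `{z | 0 < z 1 < z 0 < 1, tail z ∈ σ}` over a `ℚ`-semialgebraic set
`σ ⊆ ℝⁿ⁺¹` is `ℚ`-semialgebraic: three strict polynomial inequalities and a coordinate preimage
(`IsSemialgebraic.preimage_comp`). [Bochnak–Coste–Roy 1998, §2.1] [folklore] -/
theorem isSemialgebraic_blowupDomain {n : ℕ} {σ : Set (Fin (n + 1) → ℝ)}
    (hσ : IsSemialgebraic ℚ σ) :
    IsSemialgebraic ℚ {z : Fin (n + 1 + 1) → ℝ | 0 < z 1 ∧ z 1 < z 0 ∧ z 0 < 1 ∧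
      (fun i : Fin (n + 1) => z i.succ) ∈ σ} := by
  have h1 : IsSemialgebraic ℚ {z : Fin (n + 1 + 1) → ℝ | 0 < z 1} := by
    simpa using isSemialgebraic_setOf_eval_pos (k := ℚ) (R := ℝ) (X (1 : Fin (n + 1 + 1)))
  have h2 : IsSemialgebraic ℚ {z : Fin (n + 1 + 1) → ℝ | z 1 < z 0} := by
    simpa using isSemialgebraic_setOf_eval_lt (k := ℚ) (R := ℝ) (X (1 : Fin (n + 1 + 1))) (X 0)
  have h3 : IsSemialgebraic ℚ {z : Fin (n + 1 + 1) → ℝ | z 0 < 1} := by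
    simpa using isSemialgebraic_setOf_eval_lt (k := ℚ) (R := ℝ) (X (0 : Fin (n + 1 + 1))) 1
  have h4 : IsSemialgebraic ℚ
      {z : Fin (n + 1 + 1) → ℝ | (fun i : Fin (n + 1) => z i.succ) ∈ σ} :=
    hσ.preimage_comp Fin.succ
  convert ((h1.inter h2).inter h3).inter h4 using 1
  ext z
  simp only [mem_setOf_eq, mem_inter_iff, and_assoc]

/-- On a `ℚ`-semialgebraic set `S ⊆ ℝⁿ⁺²` off `{z 0 = 0}` whose tails lie in `σ`, the blow-up
integrand `z ↦ z 1 / z 0 ^ 2 · F (tail z)` of a `ℚ`-semialgebraic function `F` on `σ` is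
`ℚ`-semialgebraic (quotient of polynomials, `isSemialgebraicFunOn_aeval_div_aeval`; cylinder over
the graph of `F`, `IsSemialgebraicFunOn.comp_tail`; products, `IsSemialgebraicFunOn.mul_holds`).
[Bochnak–Coste–Roy 1998, Prop. 2.2.6] [folklore] -/
theorem isSemialgebraicFunOn_blowupWeight_mul {n : ℕ} {S : Set (Fin (n + 1 + 1) → ℝ)}
    (hS : IsSemialgebraic ℚ S) (h0 : ∀ z ∈ S, z 0 ≠ 0) {σ : Set (Fin (n + 1) → ℝ)}
    {F : (Fin (n + 1) → ℝ) → ℝ} (hF : IsSemialgebraicFunOn ℚ σ F)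
    (hSσ : ∀ z ∈ S, (fun i : Fin (n + 1) => z i.succ) ∈ σ) :
    IsSemialgebraicFunOn ℚ S (fun z => z 1 / z 0 ^ 2 * F (fun i : Fin (n + 1) => z i.succ)) := by
  have hw : IsSemialgebraicFunOn ℚ S (fun z : Fin (n + 1 + 1) → ℝ => z 1 / z 0 ^ 2) := by
    refine (isSemialgebraicFunOn_aeval_div_aeval hS (X 1) (X 0 ^ 2) fun z hz => ?_).congr
      fun z _ => ?_
    · simpa using h0 z hz
    · simp
  exact IsSemialgebraicFunOn.mul_holds hw (hF.comp_tail.mono hSσ hS)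

/-- **The involution `f z = update z 0 (z 1 / z 0)` of the blow-up cut: derivative and Jacobian.**
Off `{z 0 = 0}`, `f` has derivative `v ↦ v + ((z 0)⁻¹ v 1 - (z 1 / z 0 ^ 2) v 0 - v 0) • e₀`, an
upper-triangular endomorphism (the identity except in row `0`, whose diagonal entry is
`-(z 1 / z 0 ^ 2)`) of determinant `-(z 1 / z 0 ^ 2)` (`Matrix.det_of_upperTriangular`).
[folklore] -/
theorem blowup_involution_data (N : ℕ) :
    ∃ f' : (Fin (N + 2) → ℝ) → (Fin (N + 2) → ℝ) →L[ℝ] (Fin (N + 2) → ℝ),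
      (∀ x : Fin (N + 2) → ℝ, x 0 ≠ 0 →
        HasFDerivAt (fun z : Fin (N + 2) → ℝ => Function.update z 0 (z 1 / z 0)) (f' x) x) ∧
      ∀ x, (f' x).det = -(x 1 / x 0 ^ 2) := by
  let π : Fin (N + 2) → (Fin (N + 2) → ℝ) →L[ℝ] ℝ := fun k =>
    ContinuousLinearMap.proj (R := ℝ) (φ := fun _ : Fin (N + 2) => ℝ) k
  let f' : (Fin (N + 2) → ℝ) → (Fin (N + 2) → ℝ) →L[ℝ] (Fin (N + 2) → ℝ) := fun x =>
    ContinuousLinearMap.id ℝ (Fin (N + 2) → ℝ) +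
      (((x 0)⁻¹ • π 1 - (x 1 / x 0 ^ 2) • π 0) - π 0).smulRight (Pi.single 0 1)
  -- the matrix entries `f' x e_l k`
  have hf' : ∀ x (k l : Fin (N + 2)), LinearMap.toMatrix'
      ((f' x : (Fin (N + 2) → ℝ) →L[ℝ] (Fin (N + 2) → ℝ)) :
        (Fin (N + 2) → ℝ) →ₗ[ℝ] (Fin (N + 2) → ℝ)) k l = (Pi.single l 1 : Fin (N + 2) → ℝ) k +
      (((x 0)⁻¹ * (Pi.single l 1 : Fin (N + 2) → ℝ) 1 -
          x 1 / x 0 ^ 2 * (Pi.single l 1 : Fin (N + 2) → ℝ) 0) -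
        (Pi.single l 1 : Fin (N + 2) → ℝ) 0) * (Pi.single 0 1 : Fin (N + 2) → ℝ) k :=
    fun x k l => rfl
  refine ⟨f', fun x hx => ?_, fun x => ?_⟩
  · have hfun : (fun z : Fin (N + 2) → ℝ => Function.update z 0 (z 1 / z 0)) =
        fun z => z + (z 1 * (z 0)⁻¹ - z 0) • (Pi.single 0 1 : Fin (N + 2) → ℝ) := by
      funext z
      ext k
      rcases eq_or_ne k 0 with rfl | hk
      · simp [div_eq_mul_inv]
      · simp [hk]
    rw [hfun]
    have hq : HasFDerivAt (fun z : Fin (N + 2) → ℝ => z 1 * (z 0)⁻¹)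
        ((x 0)⁻¹ • π 1 - (x 1 / x 0 ^ 2) • π 0) x := by
      have h := (hasFDerivAt_apply (𝕜 := ℝ) 1 x).mul
        ((hasFDerivAt_inv hx).comp x (hasFDerivAt_apply (𝕜 := ℝ) 0 x))
      refine h.congr_fderiv ?_
      ext v
      simp [π]
      ring
    exact (hasFDerivAt_id x).add ((hq.sub (hasFDerivAt_apply 0 x)).smul_const _)
  · rw [ContinuousLinearMap.det, ← LinearMap.det_toMatrix', Matrix.det_of_upperTriangular ?_]
    · have hdiag : ∀ k, LinearMap.toMatrix' ((f' x : (Fin (N + 2) → ℝ) →L[ℝ] (Fin (N + 2) → ℝ)) :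
          (Fin (N + 2) → ℝ) →ₗ[ℝ] (Fin (N + 2) → ℝ)) k k =
            if k = 0 then -(x 1 / x 0 ^ 2) else 1 := by
        intro k
        rw [hf', Pi.single_eq_same]
        rcases eq_or_ne k 0 with rfl | hk
        · rw [if_pos rfl, Pi.single_eq_same, Pi.single_eq_of_ne (Fin.zero_lt_one (n := N)).ne']
          ring
        · rw [if_neg hk, Pi.single_eq_of_ne hk, mul_zero, add_zero]
      simp [hdiag]
    · intro k l hkl
      have hkl' : l < k := hkl
      have hk0 : k ≠ 0 := Fin.pos_iff_ne_zero.mp (lt_of_le_of_lt (Fin.zero_le l) hkl')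
      rw [hf', Pi.single_eq_of_ne (ne_of_gt hkl'), Pi.single_eq_of_ne hk0, mul_zero, add_zero]


/-- The preimage under the tail projection `z ↦ (z 1, …, z m)` of a Lebesgue-null set of `ℝᵐ` is
Lebesgue-null in `ℝᵐ⁺¹` (split off coordinate `0` by the volume-preserving
`MeasurableEquiv.piFinSuccAbove _ 0`, whose inverse is `vecCons`; `vol (ℝ × N) = vol ℝ · 0`).
[folklore] -/
theorem volume_setOf_tail_mem_eq_zero {m : ℕ} {N : Set (Fin m → ℝ)} (hN : volume N = 0) :
    volume {z : Fin (m + 1) → ℝ | (fun i : Fin m => z i.succ) ∈ N} = 0 := by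
  set e : (Fin (m + 1) → ℝ) ≃ᵐ ℝ × (Fin m → ℝ) :=
    MeasurableEquiv.piFinSuccAbove (fun _ => ℝ) 0 with he_def
  have he : MeasurePreserving e volume volume :=
    volume_preserving_piFinSuccAbove (fun _ => ℝ) 0
  have he_symm : ∀ p : ℝ × (Fin m → ℝ), e.symm p = Matrix.vecCons p.1 p.2 := fun p => by
    simp [he_def, MeasurableEquiv.piFinSuccAbove_symm_apply, Fin.insertNthEquiv,
      Fin.insertNth_zero', Matrix.vecCons]
  rw [← (he.symm e).measure_preimage_equiv]
  have hpre : e.symm ⁻¹' {z : Fin (m + 1) → ℝ | (fun i : Fin m => z i.succ) ∈ N} = univ ×ˢ N := by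
    ext p
    simp only [mem_preimage, mem_setOf_eq, he_symm, Matrix.cons_val_succ, mem_prod, mem_univ,
      true_and]
  rw [hpre, Measure.volume_eq_prod, Measure.prod_prod, hN, mul_zero]

/-! ## Existence of the blow-up -/

/-- **Stub `stub_exists_blowup` (existence of the weight-slab blow-up `βʷρ`).** For a family
`ρ : IntegralRep (n + 1)` (parameter `s = z 0`) there is a representation `ρ'` in dimension
`n + 2` with domain `D = {z | 0 < z 1 < z 0 < 1, tail z ∈ ρ.domain}` (coordinates
`z = (σ, t, x)`, the sub-slab `{0 < t < σ}` of the cylinder over `ρ`) and integrand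
`z ↦ (z 1 / z 0 ^ 2) · ρ.integrand (tail z)`. The domain is `ℚ`-semialgebraic
(`isSemialgebraic_blowupDomain`), the integrand is `ℚ`-semialgebraic on it
(`isSemialgebraicFunOn_blowupWeight_mul`), and it is absolutely integrable WITHOUT Fubini: the
involution `f (σ, t, x) = (t / σ, t, x)` of `D` (`0 < t < σ < 1 ⇒ t < t / σ < 1`, `f (f z) = z`) has
Jacobian `|det f'| = t / σ ²` (`blowup_involution_data`) and does not move the tail, so by
`MeasureTheory.integrableOn_image_iff_integrableOn_abs_det_fderiv_smul` the integrability of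
`z ↦ ρ.integrand (tail z)` on `f '' D = D ⊆ (0, 1) × ρ.domain`
(`IntegralRep.integrableOn_cylinderDomain`) is that of `(t / σ ²) ρ.integrand (tail z)` on `D`.
[Kontsevich–Zagier 2001, §1.2; Bochnak–Coste–Roy 1998, §2.2] [folklore] -/
theorem stub_exists_blowup : ∀ (n : ℕ) (ρ : Literature.NumberTheory.Transcendental.KZ.IntegralRep (n + 1)), ∃ ρ' : Literature.NumberTheory.Transcendental.KZ.IntegralRep (n + 1 + 1), ρ'.domain = {z | 0 < z 1 ∧ z 1 < z 0 ∧ z 0 < 1 ∧ (fun i : Fin (n + 1) => z i.succ) ∈ ρ.domain} ∧ ρ'.integrand = fun z => z 1 / z 0 ^ 2 * ρ.integrand (fun i : Fin (n + 1) => z i.succ) := by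
  intro n ρ
  set D : Set (Fin (n + 1 + 1) → ℝ) :=
    {z | 0 < z 1 ∧ z 1 < z 0 ∧ z 0 < 1 ∧ (fun i : Fin (n + 1) => z i.succ) ∈ ρ.domain} with hD
  have hsa : IsSemialgebraic ℚ D := isSemialgebraic_blowupDomain ρ.isSemialgebraic_domain
  have hmeas : MeasurableSet D := IsSemialgebraic.measurableSet_holds hsa
  have hpos0 : ∀ z ∈ D, 0 < z 0 := fun z hz => hz.1.trans hz.2.1
  have hfi : IsSemialgebraicFunOn ℚ D
      (fun z => z 1 / z 0 ^ 2 * ρ.integrand (fun i : Fin (n + 1) => z i.succ)) :=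
    isSemialgebraicFunOn_blowupWeight_mul hsa (fun z hz => (hpos0 z hz).ne')
      ρ.isSemialgebraicFunOn_integrand (fun z hz => hz.2.2.2)
  -- integrability through the involution `f z = update z 0 (z 1 / z 0)` of `D`
  obtain ⟨f', hderiv, hdet⟩ := blowup_involution_data n
  set f : (Fin (n + 1 + 1) → ℝ) → (Fin (n + 1 + 1) → ℝ) :=
    fun z => Function.update z 0 (z 1 / z 0) with hf
  have h10 : (1 : Fin (n + 1 + 1)) ≠ 0 := (Fin.zero_lt_one (n := n)).ne'
  have hf0 : ∀ z, f z 0 = z 1 / z 0 := fun z => Function.update_self _ _ _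
  have hf1 : ∀ z, f z 1 = z 1 := fun z => Function.update_of_ne h10 _ _
  have hftail : ∀ z, (fun i : Fin (n + 1) => f z i.succ) = fun i => z i.succ :=
    fun z => funext fun i => Function.update_of_ne (Fin.succ_ne_zero i) _ _
  have hfD : ∀ z ∈ D, f z ∈ D := fun z hz => by
    refine ⟨by rw [hf1]; exact hz.1, ?_, ?_, by rw [hftail]; exact hz.2.2.2⟩
    · rw [hf1, hf0, lt_div_iff₀ (hpos0 z hz)]
      exact mul_lt_of_lt_one_right hz.1 hz.2.2.1
    · rw [hf0, div_lt_one (hpos0 z hz)]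
      exact hz.2.1
  have hff : ∀ z ∈ D, f (f z) = z := fun z hz => by
    show Function.update (f z) 0 (f z 1 / f z 0) = z
    rw [hf1, hf0, div_div_cancel₀ hz.1.ne', hf, Function.update_idem, Function.update_eq_self]
  have hinj : InjOn f D := fun z₁ hz₁ z₂ hz₂ h => by rw [← hff z₁ hz₁, ← hff z₂ hz₂, h]
  have himg : f '' D = D := by
    refine subset_antisymm (image_subset_iff.mpr fun z hz => hfD z hz) fun y hy => ?_
    exact ⟨f y, hfD y hy, hff y hy⟩
  have hh : IntegrableOn
      (fun z : Fin (n + 1 + 1) → ℝ => ρ.integrand (fun i : Fin (n + 1) => z i.succ)) D volume :=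
    ρ.integrableOn_cylinderDomain.mono_set fun z hz => ⟨hpos0 z hz, hz.2.2.1, hz.2.2.2⟩
  have hint : IntegrableOn (fun z => z 1 / z 0 ^ 2 * ρ.integrand (fun i : Fin (n + 1) => z i.succ))
      D volume := by
    refine ((integrableOn_image_iff_integrableOn_abs_det_fderiv_smul volume hmeas
      (fun x hx => (hderiv x (hpos0 x hx).ne').hasFDerivWithinAt) hinj
      (fun z : Fin (n + 1 + 1) → ℝ => ρ.integrand (fun i : Fin (n + 1) => z i.succ))).mp
        (by rw [himg]; exact hh)).congr_fun (fun z hz => ?_) hmeas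
    dsimp only
    rw [smul_eq_mul, hdet, hftail, abs_neg, abs_of_pos (div_pos hz.1 (pow_pos (hpos0 z hz) 2))]
  exact ⟨⟨D, _, hsa, hfi, hint⟩, rfl, rfl⟩

end Summit.KontsevichZagierPeriods.ValuedFieldSpecialisation
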